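import HarnessLib
import Literature.MathematicalPhysics.QuantumFieldTheory.Balaban1983to89.Beta.LeafK123Clauses
import Literature.MathematicalPhysics.QuantumFieldTheory.Balaban1983to89.Beta.ComposedRoad

/-!
# Beta / SliceLegsWindow — the TORUS-ENTRY ↦ `Pt` DICTIONARY: the three one-loop legs of the scalar torus tower,
# read as zero-extended functions on `ℤ⁴`, in the literal (W3a)₀ binder shapes `hFtail` / `hGtail` of `ComposedRoad`

HONEST FRAMING (verbatim, page 1 of everything this cell writes): discharging `BetaPertH` makes Bałaban's UV
stability UNCONDITIONAL — a real constructive-QFT result; it is NOT the continuum limit and NOT the Clay problem.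
ABSOLUTE RULE: no internally-minted statement enters as a cited fact; every hypothesis below is either kernel-proved in
the tree or an explicit hypothesis of the theorem that uses it.  THIS MODULE asserts nothing printed and proves no
estimate: it is BOOKKEEPING (modular arithmetic on the torus coordinates + the lead's monotone shell adapters) for
Bałaban's concrete SCALAR (`U = 1`) torus tower `B1RG242Torus.tower P a m²` (pv07).  Zero cited facts.
SCOPE DISCIPLINE (GAPS G-beta-21): KERNEL FOR A SCALAR `U = 1` MODEL.  The `Pt`-families defined here are readings of
the scalar tower's propagator entries; that they (their window sums, their near field) are the legs of Bałaban's YM₄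
one-loop coefficient `β̄_k` is the identification item (W3b)₀ of the an2 lane (`Beta/WindowIdentification`, binders
`hF`/`hG`/`hident` of `ComposedRoad` §8) and is NOT asserted here.

THE REQUEST (BETA-SPEC v1.9t §7.20 (e)(iii), lead strat-b12, verbatim): «after `SliceLegsLeafK0`, the torus-entry ↦ Pt
dictionary into `tailExp/tailPow_of_distFamily` (§9) for the scalar tower (then (W3a)₀-scalar is ONE `…Pow` instance
away)»; §7.21 (c)(iii): «an1-g5's distance-form tails … are the input shape of §9 `tailExp_of_distFamily` (T := T₀,
c := ⅜δ₀′/n); only the torus-entry ↦ Pt bookkeeping separates `SliceLegsLeafK0` from an hFtail instance for the scalar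
tower».

INPUT SHAPE (an1 lane, `Beta/SliceLegs` §4 ⟶ `Beta/LeafK123Clauses` §5).  For fine torus points `x ≠ x′` of `T^{(0)}`
(`Site P 0`, `2L^{m+K}` sites per direction, fine-lattice units) and every level `1 ≤ k ≤ m + K + 1`:
  `|leg_s(x,x′)| ≤ legConst/T₀(x,x′)^s · e^{−(⅜δ₀′/L^k)·T₀(x,x′)}`  and  `≤ legConst/T₀(x,x′)^s`,
`T₀ = B5Ineq137Torus.T P 0` the sup torus distance, `s = 2, 3, d` for the VALUE leg `ε^{−2}G^ε_k(x,x′)`, the GRADIENT leg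
`ε^{−1}(∂^ε_μG^ε_k)(x,x′)`, the MIXED leg `(∂^ε_μG^ε_k∂^{εᵀ}_ν)(x,x′)`, modulo `LeafK123Clauses.BlockLegDecay P a m² c₀ δ₀′`.
OUTPUT SHAPE (lead, `Beta/ComposedRoad` §8 `oneLoopDrift_of_composedLegInterfacePow`, binders verbatim):
  `hFtail : ∀ m ≥ 1, ∀ r, M (Lc^m) ≤ r → ∀ w ∈ annulus 4 r (r+1), ∀ i ∈ s,
             |F' i (Lc^m) w| ≤ R' i / ((r:ℝ)+1)^(P i).a * Real.exp (-(δ / ((Lc^m : ℕ) : ℝ)) * ((r:ℝ)+1))`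
  `hGtail : … |G' i (Lc^m) w| ≤ S' i / ((r:ℝ)+1)^(Q i).a`,        `F' G' : ι → ℕ → Pt → ℝ`, `Pt = Fin 4 → ℤ`.

WHAT IS PROVED (all [folklore]; Mathlib + tree modules only).
* §1 READING INTEGER VECTORS ON `T^{(j)}` (any `d`, any level `j`): `readSite P x₀ v = x₀ + v (mod 2L^{m+K−j})`
  coordinatewise, and the KEY IDENTITY: on the FAITHFUL BOX `2|v_μ| ≤ 2L^{m+K−j}` (all `μ`) the circular coordinate
  distance of `x₀ + v` to `x₀` is `|v_μ|` (`ccoord_readSite`, from `B4TorusKernel.MultiPeriod.circAbs_of_centred` and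
  `circAbs_add_mul` after `(x₀ + v).val ≡ x₀.val + v [ZMOD N]`), hence the sup torus distance is the sup norm:
  `T P j (readSite P x₀ v) x₀ = ‖v‖_∞` (`T_readSite`); off the diagonal iff `v ≠ 0` (`readSite_ne`).
* §2 AT `d = 4` (`hd : P.d = 4`, coordinates re-indexed by `Fin.cast hd`): `readPt P hd x₀ w` for `w : Pt`, with
  `T P j (readPt P hd x₀ w) x₀ = DyadicShell.supNorm w` whenever `2·supNorm w ≤ P.sitesPerDir j` (`T_readPt`).
* §3 ZERO-EXTENDED BOX KERNELS: `boxKernel P hd x₀ f w = f (x₀ + w) x₀` on the faithful box, `0` outside; the two TAIL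
  ADAPTERS `boxKernel_tailExp` / `boxKernel_tailPow`: a distance-form bound `|f x x′| ≤ R′/T₀^a·e^{−cT₀}` (resp. `S′/T₀^a`)
  for `x ≠ x′` gives, for EVERY `r : ℕ` and every `w ∈ annulus 4 r (r+1)`, `|boxKernel … w| ≤ R′/(r+1)^a·e^{−c(r+1)}`
  (resp. `S′/(r+1)^a`) — inside the box by the lead's `ComposedRoad.shellBound_of_distExp/_distPow` with `T := T₀ = ‖w‖_∞`,
  outside because the value is `0`.  No window floor `M n ≤ r` is needed (the road's binder follows by weakening).
* §4 THE THREE SCALAR-TOWER INSTANCES at the fine level `j = 0`, for every base point `x₀`, every volume, every level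
  `1 ≤ k ≤ m + K + 1`, modulo ONLY `BlockLegDecay P a m² c₀ δ₀′` (+ `cK0 ≤ c₀`, `0 < δ₀′ ≤ dK0`, `|a_j| ≤ ā`):
  `valueLegPt` (a = 2), `gradLegPt μ` (a = 3), `mixedLegPt μ ν` (a = 4), each in the literal `hFtail` shape
  `legConst/((r:ℝ)+1)^a · Real.exp (-((⅜δ₀′) / ((L^k : ℕ) : ℝ)) * ((r:ℝ)+1))` and `hGtail` shape `legConst/((r:ℝ)+1)^a`
  (`valueLeg_tailExp/_tailPow`, `gradLeg_tailExp/_tailPow`, `mixedLeg_tailExp/_tailPow`).  The level is a plain `k : ℕ`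
  (the abstract `B5.Setting` of the (1.137) engine is instantiated by `levelSetting k`, whose only used field is `k`).
* §5 POWER-INDEXED PACKAGING for the road's admissible blocking factors `n = Lc^m`: `powIndexed Lc Φ n := Φ (Nat.log Lc n)`
  with `powIndexed Lc Φ (Lc^m) = Φ m` (`Nat.log_pow`); `legConst` depends on `P` through `(d, L)` only (`legConst_eq_of_eq`);
  and the SEQUENCE-OF-TOWERS corollaries `valueLeg_hFtail` / `valueLeg_hGtail` (similarly `grad…`, `mixed…`): for towers
  `Pf m` with `d = 4`, the road's fixed `L`, `m ≤ (Pf m).m + (Pf m).K + 1` levels available, base points `x₀ m`, and ONE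
  pair `(c₀, δ₀′)` with `BlockLegDecay (Pf m) a m² c₀ δ₀′` for all `m`, the families
  `F' := powIndexed L (fun m => valueLegPt (Pf m) a m² (hd m) m (x₀ m))` satisfy the displayed `hFtail`/`hGtail` binders
  (one leg index `i`; `M` arbitrary) with `R′ = S′ = legConst`, `δ = ⅜δ₀′`, `Lc = L`.
NET for the lead: with `BlockLegDecay` supplied uniformly along a tower sequence (pv23 / pv07 lineages: value + gradient
block legs, covariance — cf. `B4Ineq116Torus.cov116_torus`/`GQ_decay_torus`, constants quantified BEFORE `P`), the
(W3a)₀ binders `hFtail`, `hGtail` of `…composedLegInterfacePow` for the scalar tower's legs are literal instances of §5;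
`hF`/`hG`/`hident` remain the an2 lane's.

WHAT THIS DOES NOT DO.  (i) No estimate: every decay input is the hypothesis `BlockLegDecay`.  (ii) No identification
with Bałaban's coefficient (G-beta-21, above).  (iii) The reading `w ↦ x₀ + w` is NOT injective on the closed faithful
box (antipodal boundary points `±L^{m+K−j}e_μ` coincide on the torus); nothing here uses injectivity — the bounds are
pointwise in `w`.  (iv) Legs are read with the `Pt`-variable in the FIRST (row) argument, base point second; the other
order is the same adapter applied to `fun x x′ => f x′ x` (the distance-form hypotheses are symmetric in the two points).

Context (orientation only; not used in proofs; quoted in `Beta/SliceLegs`).  [B5] p. 40 (1.137): the three-slice formula for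
`G_k` whose located leaf (2.35)–(2.37) of [B4] Lemma 2.4 p. 582 is the content of `BlockLegDecay`.
B4 = [cite: Balaban1983RegularityDecay]; B5 = [cite: Balaban1984PropagatorsI].
-/

namespace Literature.MathematicalPhysics.QuantumFieldTheory.Balaban1983to89

open Matrix

noncomputable section

namespace Beta.SliceLegsWindow

open B1RG242Torus
open B5Ineq137Torus (T toT Nv Nv_pos T_nonneg T_symm)
open B4TorusKernel.MultiPeriod (circAbs circAbs_add_mul circAbs_of_centred circAbs_nonneg)
open B5Leaf237C0Torus (cK0 dK0)
open Beta.DyadicShell (Pt supNorm supNorm_le_iff natAbs_le_supNorm supNorm_eq_zero_iff)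
open Beta.SliceLegs (legConst legConst_nonneg T_pos_of_ne)
open Beta.SliceLegsLeafK0 (c₀_nonneg_of_cK0_le)
open Beta.LeafK123Clauses (BlockLegDecay valueLeg_tail_of_blockLegDecay gradLeg_tail_of_blockLegDecay
  mixedLeg_tail_of_blockLegDecay)
open Beta.ComposedRoad (shellBound_of_distExp shellBound_of_distPow)
open Literature.Probability.LatticeModels (annulus)

/-! ## §1. Reading integer vectors on the torus `T^{(j)}`; the faithful box

(`Site` below is the tree's torus-site type `Balaban1983to89.Site P j = Fin P.d → ZMod (P.sitesPerDir j)`, written with its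
qualified name because the β-road modules imported here also declare a `Beta.Site`.) -/

/-- Value arithmetic in `ZMod N`: `(x + z).val ≡ x.val + z (mod N)`. [folklore] -/
theorem val_add_intCast_modEq {N : ℕ} [NeZero N] (x : ZMod N) (z : ℤ) :
    (((x + (z : ZMod N)).val : ℕ) : ℤ) ≡ (x.val : ℤ) + z [ZMOD N] := by
  have h1 : ((((x + (z : ZMod N)).val : ℕ) : ℤ) : ZMod N) = x + (z : ZMod N) := by
    rw [Int.cast_natCast, ZMod.natCast_zmod_val]
  have h2 : (((x.val : ℤ) + z : ℤ) : ZMod N) = x + (z : ZMod N) := by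
    push_cast
    rw [ZMod.natCast_zmod_val]
  exact (ZMod.intCast_eq_intCast_iff _ _ _).mp (h1.trans h2.symm)

/-- Hence the circular distance of `(x + z).val` to `x.val` is that of `z` to `0`. [folklore] -/
theorem circAbs_val_add_intCast {N : ℕ} [NeZero N] (x : ZMod N) (z : ℤ) :
    circAbs N ((((x + (z : ZMod N)).val : ℕ) : ℤ) - (x.val : ℤ)) = circAbs N z := by
  obtain ⟨t, ht⟩ := Int.modEq_iff_dvd.mp (val_add_intCast_modEq x z).symm
  have e : (((x + (z : ZMod N)).val : ℕ) : ℤ) - (x.val : ℤ) = z + N * t := by linarith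
  rw [e, circAbs_add_mul]

variable (P : Params)

/-- THE READING MAP: `x₀ + v` on `T^{(j)}`, coordinatewise modulo `sitesPerDir j = 2L^{m+K−j}`. [folklore] -/
def readSite {j : ℕ} (x₀ : Balaban1983to89.Site P j) (v : Fin P.d → ℤ) : Balaban1983to89.Site P j :=
  fun μ => x₀ μ + ((v μ : ℤ) : ZMod (P.sitesPerDir j))

/-- Coordinates of the reading. [folklore] -/
theorem readSite_apply {j : ℕ} (x₀ : Balaban1983to89.Site P j) (v : Fin P.d → ℤ) (μ : Fin P.d) :
    readSite P x₀ v μ = x₀ μ + ((v μ : ℤ) : ZMod (P.sitesPerDir j)) := rfl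

/-- Reading the zero vector gives the base point. [folklore] -/
@[simp] theorem readSite_zero {j : ℕ} (x₀ : Balaban1983to89.Site P j) : readSite P x₀ 0 = x₀ := by
  funext μ
  simp [readSite_apply]

/-- The sup norm `‖v‖_∞ = max_μ |v_μ|` of an integer vector, as a natural number (`DyadicShell.supNorm` is the case `d = 4`).
[folklore] -/
def vecSup {d : ℕ} (v : Fin d → ℤ) : ℕ := Finset.univ.sup fun μ => (v μ).natAbs

/-- Each coordinate is bounded by the sup norm. [folklore] -/
theorem natAbs_le_vecSup {d : ℕ} (v : Fin d → ℤ) (μ : Fin d) : (v μ).natAbs ≤ vecSup v :=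
  Finset.le_sup (f := fun μ => (v μ).natAbs) (Finset.mem_univ μ)

/-- `‖v‖_∞ ≤ n ↔ ∀ μ, |v_μ| ≤ n`. [folklore] -/
theorem vecSup_le_iff {d : ℕ} {v : Fin d → ℤ} {n : ℕ} : vecSup v ≤ n ↔ ∀ μ, (v μ).natAbs ≤ n := by
  unfold vecSup
  rw [Finset.sup_le_iff]
  exact ⟨fun h μ => h μ (Finset.mem_univ μ), fun h μ _ => h μ⟩

/-- `‖v‖_∞ = 0 ↔ v = 0`. [folklore] -/
theorem vecSup_eq_zero_iff {d : ℕ} {v : Fin d → ℤ} : vecSup v = 0 ↔ v = 0 := by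
  constructor
  · intro h
    funext μ
    have hμ := natAbs_le_vecSup v μ
    rw [h, Nat.le_zero, Int.natAbs_eq_zero] at hμ
    exact hμ
  · rintro rfl
    exact Nat.le_zero.mp (vecSup_le_iff.mpr fun μ => by simp)

/-- THE FAITHFUL BOX of `T^{(j)}`: `2|v_μ| ≤ sitesPerDir j` for all `μ`, i.e. `2‖v‖_∞ ≤ 2L^{m+K−j}`. [folklore] -/
theorem two_mul_abs_le_of_vecSup {d : ℕ} {v : Fin d → ℤ} {N : ℕ} (h : 2 * vecSup v ≤ N) (μ : Fin d) :
    2 * |v μ| ≤ (N : ℤ) := by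
  have hμ : 2 * (v μ).natAbs ≤ N := (Nat.mul_le_mul_left 2 (natAbs_le_vecSup v μ)).trans h
  have : ((2 * (v μ).natAbs : ℕ) : ℤ) ≤ (N : ℤ) := by exact_mod_cast hμ
  simpa [Int.natCast_natAbs] using this

/-- KEY IDENTITY, coordinatewise: on the faithful box the circular coordinate distance of `x₀ + v` to `x₀` is `|v_μ|`.
[folklore] -/
theorem ccoord_readSite {j : ℕ} (x₀ : Balaban1983to89.Site P j) {v : Fin P.d → ℤ} (μ : Fin P.d)
    (hv : 2 * |v μ| ≤ (P.sitesPerDir j : ℤ)) :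
    B4Sect5Torus.ccoord (Nv P j) (toT (readSite P x₀ v)) (toT x₀) μ = (v μ).natAbs := by
  apply Int.ofNat.inj
  simp only [Int.ofNat_eq_natCast]
  rw [B4Sect5Torus.ccoord_cast (Nv_pos P j), Int.natCast_natAbs]
  show circAbs (P.sitesPerDir j) ((((readSite P x₀ v) μ).val : ℤ) - ((x₀ μ).val : ℤ)) = |v μ|
  rw [readSite_apply, circAbs_val_add_intCast]
  exact circAbs_of_centred (P.one_lt_sitesPerDir j).le hv

/-- KEY IDENTITY: on the faithful box the sup torus distance of `x₀ + v` to `x₀` (in level-`j` lattice units) is `‖v‖_∞`.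
[folklore] -/
theorem T_readSite {j : ℕ} (x₀ : Balaban1983to89.Site P j) {v : Fin P.d → ℤ} (hv : 2 * vecSup v ≤ P.sitesPerDir j) :
    T P j (readSite P x₀ v) x₀ = ((vecSup v : ℕ) : ℝ) := by
  unfold T B4Sect5Torus.tdist
  have hfun : B4Sect5Torus.ccoord (Nv P j) (toT (readSite P x₀ v)) (toT x₀) = fun μ => (v μ).natAbs := by
    funext μ
    exact ccoord_readSite P x₀ μ (two_mul_abs_le_of_vecSup hv μ)
  rw [hfun]
  rfl

/-- The same with the arguments of `T` exchanged. [folklore] -/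
theorem T_readSite' {j : ℕ} (x₀ : Balaban1983to89.Site P j) {v : Fin P.d → ℤ} (hv : 2 * vecSup v ≤ P.sitesPerDir j) :
    T P j x₀ (readSite P x₀ v) = ((vecSup v : ℕ) : ℝ) := by
  rw [T_symm, T_readSite P x₀ hv]

/-- On the faithful box a nonzero vector reads off the base point. [folklore] -/
theorem readSite_ne {j : ℕ} (x₀ : Balaban1983to89.Site P j) {v : Fin P.d → ℤ} (hv0 : v ≠ 0)
    (hv : 2 * vecSup v ≤ P.sitesPerDir j) : readSite P x₀ v ≠ x₀ := by
  intro h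
  have hT := T_readSite P x₀ hv
  rw [h, B5Ineq137Torus.T_self] at hT
  have h0 : vecSup v = 0 := by exact_mod_cast hT.symm
  exact hv0 (vecSup_eq_zero_iff.mp h0)

/-! ## §2. `d = 4`: reading points of `ℤ⁴` (`Pt`) -/

/-- A point of `ℤ⁴` as an integer vector indexed by `Fin P.d`, `P.d = 4`. [folklore] -/
def vecOfPt (hd : P.d = 4) (w : Pt) : Fin P.d → ℤ := fun μ => w (Fin.cast hd μ)

/-- `vecOfPt` of `0` is `0`. [folklore] -/
@[simp] theorem vecOfPt_zero (hd : P.d = 4) : vecOfPt P hd 0 = 0 := rfl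

/-- `vecOfPt` is injective (re-indexing along the bijection `Fin.cast hd`). [folklore] -/
theorem vecOfPt_eq_zero_iff (hd : P.d = 4) {w : Pt} : vecOfPt P hd w = 0 ↔ w = 0 := by
  constructor
  · intro h
    funext i
    have := congrFun h (Fin.cast hd.symm i)
    simpa [vecOfPt] using this
  · rintro rfl
    rfl

/-- The re-indexed sup norm is `DyadicShell.supNorm`. [folklore] -/
theorem vecSup_vecOfPt (hd : P.d = 4) (w : Pt) : vecSup (vecOfPt P hd w) = supNorm w := by
  apply le_antisymm
  · exact vecSup_le_iff.mpr fun μ => natAbs_le_supNorm w (Fin.cast hd μ)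
  · refine supNorm_le_iff.mpr fun i => ?_
    have h := natAbs_le_vecSup (vecOfPt P hd w) (Fin.cast hd.symm i)
    simpa [vecOfPt] using h

/-- THE `Pt`-READING MAP at `d = 4`: `readPt P hd x₀ w = x₀ + w (mod sitesPerDir j)`. [folklore] -/
def readPt (hd : P.d = 4) {j : ℕ} (x₀ : Balaban1983to89.Site P j) (w : Pt) : Balaban1983to89.Site P j :=
  readSite P x₀ (vecOfPt P hd w)

/-- Reading `0` gives the base point. [folklore] -/
@[simp] theorem readPt_zero (hd : P.d = 4) {j : ℕ} (x₀ : Balaban1983to89.Site P j) : readPt P hd x₀ 0 = x₀ := by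
  simp [readPt]

/-- KEY IDENTITY at `d = 4`: on the faithful box `2‖w‖_∞ ≤ sitesPerDir j` the sup torus distance of the reading to the base
point is `‖w‖_∞`. [folklore] -/
theorem T_readPt (hd : P.d = 4) {j : ℕ} (x₀ : Balaban1983to89.Site P j) {w : Pt}
    (hw : 2 * supNorm w ≤ P.sitesPerDir j) : T P j (readPt P hd x₀ w) x₀ = ((supNorm w : ℕ) : ℝ) := by
  have hv : 2 * vecSup (vecOfPt P hd w) ≤ P.sitesPerDir j := by rwa [vecSup_vecOfPt]
  rw [readPt, T_readSite P x₀ hv, vecSup_vecOfPt]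

/-- The same with the arguments of `T` exchanged. [folklore] -/
theorem T_readPt' (hd : P.d = 4) {j : ℕ} (x₀ : Balaban1983to89.Site P j) {w : Pt}
    (hw : 2 * supNorm w ≤ P.sitesPerDir j) : T P j x₀ (readPt P hd x₀ w) = ((supNorm w : ℕ) : ℝ) := by
  rw [T_symm, T_readPt P hd x₀ hw]

/-- On the faithful box a nonzero `w` reads off the base point. [folklore] -/
theorem readPt_ne (hd : P.d = 4) {j : ℕ} (x₀ : Balaban1983to89.Site P j) {w : Pt} (hw0 : w ≠ 0)
    (hw : 2 * supNorm w ≤ P.sitesPerDir j) : readPt P hd x₀ w ≠ x₀ := by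
  have hv : 2 * vecSup (vecOfPt P hd w) ≤ P.sitesPerDir j := by rwa [vecSup_vecOfPt]
  exact readSite_ne P x₀ (fun h => hw0 ((vecOfPt_eq_zero_iff P hd).mp h)) hv

/-! ## §3. Zero-extended box kernels and the two tail adapters -/

/-- THE ZERO-EXTENDED `Pt`-READING of a two-point kernel `f` on `T^{(j)}` at the base point `x₀`:
`w ↦ f (x₀ + w) x₀` on the faithful box `2‖w‖_∞ ≤ sitesPerDir j`, `0` outside. [folklore] -/
def boxKernel (hd : P.d = 4) {j : ℕ} (x₀ : Balaban1983to89.Site P j)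
    (f : Balaban1983to89.Site P j → Balaban1983to89.Site P j → ℝ) : Pt → ℝ :=
  fun w => if 2 * supNorm w ≤ P.sitesPerDir j then f (readPt P hd x₀ w) x₀ else 0

variable {P}

/-- Inside the faithful box the box kernel is the torus entry. [folklore] -/
theorem boxKernel_of_le (hd : P.d = 4) {j : ℕ} (x₀ : Balaban1983to89.Site P j)
    (f : Balaban1983to89.Site P j → Balaban1983to89.Site P j → ℝ) {w : Pt} (hw : 2 * supNorm w ≤ P.sitesPerDir j) :
    boxKernel P hd x₀ f w = f (readPt P hd x₀ w) x₀ := if_pos hw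

/-- Outside the faithful box the box kernel vanishes. [folklore] -/
theorem boxKernel_of_not_le (hd : P.d = 4) {j : ℕ} (x₀ : Balaban1983to89.Site P j)
    (f : Balaban1983to89.Site P j → Balaban1983to89.Site P j → ℝ) {w : Pt} (hw : ¬ 2 * supNorm w ≤ P.sitesPerDir j) :
    boxKernel P hd x₀ f w = 0 := if_neg hw

/-- At `w = 0` the box kernel is the diagonal entry `f x₀ x₀`. [folklore] -/
theorem boxKernel_zero (hd : P.d = 4) {j : ℕ} (x₀ : Balaban1983to89.Site P j)
    (f : Balaban1983to89.Site P j → Balaban1983to89.Site P j → ℝ) : boxKernel P hd x₀ f 0 = f x₀ x₀ := by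
  rw [boxKernel_of_le hd x₀ f (by simp [supNorm_eq_zero_iff.mpr rfl]), readPt_zero]

/-- **TAIL ADAPTER, EXPONENTIAL FORM** (`hFtail` shape).  A distance-form bound `|f x x′| ≤ R′/T₀(x,x′)^a·e^{−c·T₀(x,x′)}` for
`x ≠ x′` (`R′, c ≥ 0`) gives, for every `r` and every `w` on the shell `‖w‖_∞ = r + 1`,
`|boxKernel … f w| ≤ R′/(r+1)^a·e^{−c(r+1)}` — the lead's `shellBound_of_distExp` with `T := T₀ = ‖w‖_∞` inside the box,
the value `0` outside. [folklore] -/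
theorem boxKernel_tailExp (hd : P.d = 4) {j : ℕ} (x₀ : Balaban1983to89.Site P j)
    {f : Balaban1983to89.Site P j → Balaban1983to89.Site P j → ℝ} {R' c : ℝ} {a : ℕ} (hR : 0 ≤ R') (hc : 0 ≤ c)
    (h : ∀ x x' : Balaban1983to89.Site P j, x ≠ x' → |f x x'| ≤ R' / T P j x x' ^ a * Real.exp (-c * T P j x x')) :
    ∀ r : ℕ, ∀ w ∈ annulus 4 r (r + 1),
      |boxKernel P hd x₀ f w| ≤ R' / ((r : ℝ) + 1) ^ a * Real.exp (-c * ((r : ℝ) + 1)) := by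
  intro r w hw
  by_cases hb : 2 * supNorm w ≤ P.sitesPerDir j
  · rw [boxKernel_of_le hd x₀ f hb]
    have hx : readPt P hd x₀ w ≠ x₀ := readPt_ne P hd x₀ (DyadicShell.ne_zero_of_mem_annulus hw) hb
    exact shellBound_of_distExp hR hc hw (le_of_eq (T_readPt P hd x₀ hb).symm) (h _ _ hx)
  · rw [boxKernel_of_not_le hd x₀ f hb, abs_zero]
    positivity

/-- **TAIL ADAPTER, PURE POWER** (`hGtail` shape).  `|f x x′| ≤ S′/T₀(x,x′)^a` for `x ≠ x′` (`S′ ≥ 0`) gives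
`|boxKernel … f w| ≤ S′/(r+1)^a` on the shell `‖w‖_∞ = r + 1`. [folklore] -/
theorem boxKernel_tailPow (hd : P.d = 4) {j : ℕ} (x₀ : Balaban1983to89.Site P j)
    {f : Balaban1983to89.Site P j → Balaban1983to89.Site P j → ℝ} {S' : ℝ} {a : ℕ} (hS : 0 ≤ S')
    (h : ∀ x x' : Balaban1983to89.Site P j, x ≠ x' → |f x x'| ≤ S' / T P j x x' ^ a) :
    ∀ r : ℕ, ∀ w ∈ annulus 4 r (r + 1), |boxKernel P hd x₀ f w| ≤ S' / ((r : ℝ) + 1) ^ a := by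
  intro r w hw
  by_cases hb : 2 * supNorm w ≤ P.sitesPerDir j
  · rw [boxKernel_of_le hd x₀ f hb]
    have hx : readPt P hd x₀ w ≠ x₀ := readPt_ne P hd x₀ (DyadicShell.ne_zero_of_mem_annulus hw) hb
    exact shellBound_of_distPow hS hw (le_of_eq (T_readPt P hd x₀ hb).symm) (h _ _ hx)
  · rw [boxKernel_of_not_le hd x₀ f hb, abs_zero]
    positivity

/-! ## §4. The three legs of the scalar torus tower as `Pt`-families, in the `hFtail` / `hGtail` shapes -/

/-- A `B5.Setting` carrying the level `k` (every other field trivial): the (1.137) engine of `SliceLegs` reads only `S.k`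
for the concrete tower, so the leg theorems below are stated for a plain level `k : ℕ`. [folklore] -/
def levelSetting (k : ℕ) : B5.Setting where
  Site := Unit
  dist := fun _ _ => 0
  k := k
  Loc := Unit
  suppIn := fun _ _ => True
  supNorm := fun _ => 0
  l2Norm := fun _ => 0
  holder := fun _ _ => 0
  Cut := Unit
  cutIn := fun _ _ => True
  cutH := fun _ _ => 0
  cutSup := fun _ => 0
  l2op := fun _ _ => 0
  e := fun _ _ _ => 0
  h1 := fun _ _ _ => 0
  e4 := fun _ _ => 0
  h2 := fun _ _ _ => 0
  l2loc := fun _ _ _ => 0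
  Vec := Unit
  formΔa := fun _ => 0
  formΔI := fun _ => 0

/-- Its level field. [folklore] -/
@[simp] theorem levelSetting_k (k : ℕ) : (levelSetting k).k = k := rfl

variable (P)

/-- THE VALUE LEG as a `Pt`-family: `w ↦ ε^{−2}G^ε_k(x₀ + w, x₀)`, zero-extended off the faithful box of `T^{(0)}`. [folklore] -/
def valueLegPt (a msq : ℝ) (hd : P.d = 4) (k : ℕ) (x₀ : Balaban1983to89.Site P 0) : Pt → ℝ :=
  boxKernel P hd x₀ fun x x' => (P.eps ^ 2)⁻¹ * (tower P a msq).G k x x'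

/-- THE GRADIENT LEG as a `Pt`-family: `w ↦ ε^{−1}(∂^ε_μG^ε_k)(x₀ + w, x₀)`, zero-extended. [folklore] -/
def gradLegPt (a msq : ℝ) (hd : P.d = 4) (k : ℕ) (μ : Fin P.d) (x₀ : Balaban1983to89.Site P 0) : Pt → ℝ :=
  boxKernel P hd x₀ fun x x' => P.eps⁻¹ * (deriv P 0 P.eps μ * (tower P a msq).G k) x x'

/-- THE MIXED LEG as a `Pt`-family: `w ↦ (∂^ε_μG^ε_k∂^{εᵀ}_ν)(x₀ + w, x₀)`, zero-extended. [folklore] -/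
def mixedLegPt (a msq : ℝ) (hd : P.d = 4) (k : ℕ) (μ ν : Fin P.d) (x₀ : Balaban1983to89.Site P 0) : Pt → ℝ :=
  boxKernel P hd x₀ fun x x' => (deriv P 0 P.eps μ * (tower P a msq).G k * (deriv P 0 P.eps ν)ᵀ) x x'

variable {P}

/-- The road writes the rate as `δ / ((L^k : ℕ) : ℝ)`; `SliceLegs` as `⅜δ₀′/(L:ℝ)^k`. [folklore] -/
theorem rate_cast (δ₀' : ℝ) (L k : ℕ) : 3 / 8 * δ₀' / (L : ℝ) ^ k = 3 / 8 * δ₀' / ((L ^ k : ℕ) : ℝ) := by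
  push_cast
  ring

/-- **VALUE LEG, `hFtail` SHAPE** (`a = 2`): for the scalar torus tower at `d = 4`, level `1 ≤ k ≤ m + K + 1`, base point
`x₀`, modulo `BlockLegDecay`: `|valueLegPt w| ≤ legConst/((r:ℝ)+1)^2 · e^{−(⅜δ₀′/L^k)(r+1)}` on every shell `‖w‖_∞ = r+1`.
[cite: Balaban1984PropagatorsI, (1.137) p.40] -/
theorem valueLeg_tailExp (hd : P.d = 4) {a msq : ℝ} (ha : 0 < a) (hm : 0 ≤ msq) {k : ℕ} (hk : 1 ≤ k)
    (hkK : k ≤ P.m + P.K + 1) {c₀ δ₀' ā : ℝ} (hc : cK0 P.d P.L a msq ≤ c₀) (hδ : 0 < δ₀')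
    (hδ' : δ₀' ≤ dK0 P.d P.L a msq) (hā : ∀ j, |B1.aSeq a P.L j| ≤ ā) (H : BlockLegDecay P a msq c₀ δ₀')
    (x₀ : Balaban1983to89.Site P 0) :
    ∀ r : ℕ, ∀ w ∈ annulus 4 r (r + 1), |valueLegPt P a msq hd k x₀ w|
      ≤ legConst P c₀ δ₀' ā 2 / ((r : ℝ) + 1) ^ 2 * Real.exp (-(3 / 8 * δ₀' / ((P.L ^ k : ℕ) : ℝ)) * ((r : ℝ) + 1)) := by
  have hds : P.d = 2 + 2 := by rw [hd]
  have hc₀ : 0 ≤ c₀ := c₀_nonneg_of_cK0_le (P := P) ha hc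
  rw [← rate_cast]
  refine boxKernel_tailExp hd x₀ (legConst_nonneg hc₀ hδ ā 2) (by positivity) fun x x' hx => ?_
  exact (valueLeg_tail_of_blockLegDecay (S := levelSetting k) ha hm (by norm_num) hds hk hkK hc hδ hδ' hā H hx).1

/-- **VALUE LEG, `hGtail` SHAPE** (`a = 2`): `|valueLegPt w| ≤ legConst/((r:ℝ)+1)^2`. [cite: Balaban1984PropagatorsI, (1.137) p.40] -/
theorem valueLeg_tailPow (hd : P.d = 4) {a msq : ℝ} (ha : 0 < a) (hm : 0 ≤ msq) {k : ℕ} (hk : 1 ≤ k)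
    (hkK : k ≤ P.m + P.K + 1) {c₀ δ₀' ā : ℝ} (hc : cK0 P.d P.L a msq ≤ c₀) (hδ : 0 < δ₀')
    (hδ' : δ₀' ≤ dK0 P.d P.L a msq) (hā : ∀ j, |B1.aSeq a P.L j| ≤ ā) (H : BlockLegDecay P a msq c₀ δ₀')
    (x₀ : Balaban1983to89.Site P 0) :
    ∀ r : ℕ, ∀ w ∈ annulus 4 r (r + 1), |valueLegPt P a msq hd k x₀ w| ≤ legConst P c₀ δ₀' ā 2 / ((r : ℝ) + 1) ^ 2 := by
  have hds : P.d = 2 + 2 := by rw [hd]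
  have hc₀ : 0 ≤ c₀ := c₀_nonneg_of_cK0_le (P := P) ha hc
  refine boxKernel_tailPow hd x₀ (legConst_nonneg hc₀ hδ ā 2) fun x x' hx => ?_
  exact (valueLeg_tail_of_blockLegDecay (S := levelSetting k) ha hm (by norm_num) hds hk hkK hc hδ hδ' hā H hx).2

/-- **GRADIENT LEG, `hFtail` SHAPE** (`a = 3`). [cite: Balaban1984PropagatorsI, (1.137) p.40] -/
theorem gradLeg_tailExp (hd : P.d = 4) {a msq : ℝ} (ha : 0 < a) (hm : 0 ≤ msq) {k : ℕ} (hk : 1 ≤ k)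
    (hkK : k ≤ P.m + P.K + 1) {c₀ δ₀' ā : ℝ} (hc : cK0 P.d P.L a msq ≤ c₀) (hδ : 0 < δ₀')
    (hδ' : δ₀' ≤ dK0 P.d P.L a msq) (hā : ∀ j, |B1.aSeq a P.L j| ≤ ā) (H : BlockLegDecay P a msq c₀ δ₀')
    (μ : Fin P.d) (x₀ : Balaban1983to89.Site P 0) :
    ∀ r : ℕ, ∀ w ∈ annulus 4 r (r + 1), |gradLegPt P a msq hd k μ x₀ w|
      ≤ legConst P c₀ δ₀' ā 3 / ((r : ℝ) + 1) ^ 3 * Real.exp (-(3 / 8 * δ₀' / ((P.L ^ k : ℕ) : ℝ)) * ((r : ℝ) + 1)) := by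
  have hds : P.d = 3 + 1 := by rw [hd]
  have hc₀ : 0 ≤ c₀ := c₀_nonneg_of_cK0_le (P := P) ha hc
  rw [← rate_cast]
  refine boxKernel_tailExp hd x₀ (legConst_nonneg hc₀ hδ ā 3) (by positivity) fun x x' hx => ?_
  exact (gradLeg_tail_of_blockLegDecay (S := levelSetting k) ha hm (by norm_num) hds hk hkK hc hδ hδ' hā H μ hx).1

/-- **GRADIENT LEG, `hGtail` SHAPE** (`a = 3`). [cite: Balaban1984PropagatorsI, (1.137) p.40] -/
theorem gradLeg_tailPow (hd : P.d = 4) {a msq : ℝ} (ha : 0 < a) (hm : 0 ≤ msq) {k : ℕ} (hk : 1 ≤ k)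
    (hkK : k ≤ P.m + P.K + 1) {c₀ δ₀' ā : ℝ} (hc : cK0 P.d P.L a msq ≤ c₀) (hδ : 0 < δ₀')
    (hδ' : δ₀' ≤ dK0 P.d P.L a msq) (hā : ∀ j, |B1.aSeq a P.L j| ≤ ā) (H : BlockLegDecay P a msq c₀ δ₀')
    (μ : Fin P.d) (x₀ : Balaban1983to89.Site P 0) :
    ∀ r : ℕ, ∀ w ∈ annulus 4 r (r + 1), |gradLegPt P a msq hd k μ x₀ w| ≤ legConst P c₀ δ₀' ā 3 / ((r : ℝ) + 1) ^ 3 := by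
  have hds : P.d = 3 + 1 := by rw [hd]
  have hc₀ : 0 ≤ c₀ := c₀_nonneg_of_cK0_le (P := P) ha hc
  refine boxKernel_tailPow hd x₀ (legConst_nonneg hc₀ hδ ā 3) fun x x' hx => ?_
  exact (gradLeg_tail_of_blockLegDecay (S := levelSetting k) ha hm (by norm_num) hds hk hkK hc hδ hδ' hā H μ hx).2

/-- **MIXED LEG, `hFtail` SHAPE** (`a = 4 = d`). [cite: Balaban1984PropagatorsI, (1.137) p.40] -/
theorem mixedLeg_tailExp (hd : P.d = 4) {a msq : ℝ} (ha : 0 < a) (hm : 0 ≤ msq) {k : ℕ} (hk : 1 ≤ k)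
    (hkK : k ≤ P.m + P.K + 1) {c₀ δ₀' ā : ℝ} (hc : cK0 P.d P.L a msq ≤ c₀) (hδ : 0 < δ₀')
    (hδ' : δ₀' ≤ dK0 P.d P.L a msq) (hā : ∀ j, |B1.aSeq a P.L j| ≤ ā) (H : BlockLegDecay P a msq c₀ δ₀')
    (μ ν : Fin P.d) (x₀ : Balaban1983to89.Site P 0) :
    ∀ r : ℕ, ∀ w ∈ annulus 4 r (r + 1), |mixedLegPt P a msq hd k μ ν x₀ w|
      ≤ legConst P c₀ δ₀' ā 4 / ((r : ℝ) + 1) ^ 4 * Real.exp (-(3 / 8 * δ₀' / ((P.L ^ k : ℕ) : ℝ)) * ((r : ℝ) + 1)) := by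
  have hc₀ : 0 ≤ c₀ := c₀_nonneg_of_cK0_le (P := P) ha hc
  rw [← rate_cast]
  refine boxKernel_tailExp hd x₀ (legConst_nonneg hc₀ hδ ā 4) (by positivity) fun x x' hx => ?_
  have h := (mixedLeg_tail_of_blockLegDecay (S := levelSetting k) ha hm hk hkK hc hδ hδ' hā H μ ν hx).1
  rw [hd] at h
  exact h

/-- **MIXED LEG, `hGtail` SHAPE** (`a = 4 = d`). [cite: Balaban1984PropagatorsI, (1.137) p.40] -/
theorem mixedLeg_tailPow (hd : P.d = 4) {a msq : ℝ} (ha : 0 < a) (hm : 0 ≤ msq) {k : ℕ} (hk : 1 ≤ k)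
    (hkK : k ≤ P.m + P.K + 1) {c₀ δ₀' ā : ℝ} (hc : cK0 P.d P.L a msq ≤ c₀) (hδ : 0 < δ₀')
    (hδ' : δ₀' ≤ dK0 P.d P.L a msq) (hā : ∀ j, |B1.aSeq a P.L j| ≤ ā) (H : BlockLegDecay P a msq c₀ δ₀')
    (μ ν : Fin P.d) (x₀ : Balaban1983to89.Site P 0) :
    ∀ r : ℕ, ∀ w ∈ annulus 4 r (r + 1), |mixedLegPt P a msq hd k μ ν x₀ w| ≤ legConst P c₀ δ₀' ā 4 / ((r : ℝ) + 1) ^ 4 := by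
  have hc₀ : 0 ≤ c₀ := c₀_nonneg_of_cK0_le (P := P) ha hc
  refine boxKernel_tailPow hd x₀ (legConst_nonneg hc₀ hδ ā 4) fun x x' hx => ?_
  have h := (mixedLeg_tail_of_blockLegDecay (S := levelSetting k) ha hm hk hkK hc hδ hδ' hā H μ ν hx).2
  rw [hd] at h
  exact h

/-! ## §5. Power-indexed packaging along the road's admissible blocking factors `n = Lc^m` -/

/-- A sequence indexed by the exponent `m`, read at the blocking factor `n = Lc^m` (`Nat.log` recovers `m`). [folklore] -/
def powIndexed {X : Sort*} (Lc : ℕ) (Φ : ℕ → X) : ℕ → X := fun n => Φ (Nat.log Lc n)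

/-- At the powers the packaging returns the `m`-th term. [folklore] -/
theorem powIndexed_pow {X : Sort*} {Lc : ℕ} (hL : 1 < Lc) (Φ : ℕ → X) (m : ℕ) :
    powIndexed Lc Φ (Lc ^ m) = Φ m := by
  simp [powIndexed, Nat.log_pow hL]

/-- `legConst` depends on the tower parameters through `(d, L)` only. [folklore] -/
theorem legConst_eq_of_eq {P P' : Params} (hd : P.d = P'.d) (hL : P.L = P'.L) (c₀ δ₀' ā : ℝ) (s : ℕ) :
    legConst P c₀ δ₀' ā s = legConst P' c₀ δ₀' ā s := by
  unfold legConst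
  rw [hd, hL]

/-- FROM PER-LEVEL SHELL BOUNDS TO THE ROAD'S `hFtail` BINDER (one leg index; the window floor is discarded). [folklore] -/
theorem hFtail_of_levels {Lc : ℕ} (hL : 1 < Lc) {Φ : ℕ → Pt → ℝ} {R' δ : ℝ} {a : ℕ} {M : ℕ → ℕ}
    (h : ∀ m : ℕ, 1 ≤ m → ∀ r : ℕ, ∀ w ∈ annulus 4 r (r + 1),
      |Φ m w| ≤ R' / ((r : ℝ) + 1) ^ a * Real.exp (-(δ / ((Lc ^ m : ℕ) : ℝ)) * ((r : ℝ) + 1))) :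
    ∀ m : ℕ, 1 ≤ m → ∀ r : ℕ, M (Lc ^ m) ≤ r → ∀ w ∈ annulus 4 r (r + 1),
      |powIndexed Lc Φ (Lc ^ m) w| ≤ R' / ((r : ℝ) + 1) ^ a * Real.exp (-(δ / ((Lc ^ m : ℕ) : ℝ)) * ((r : ℝ) + 1)) := by
  intro m hm r _ w hw
  rw [powIndexed_pow hL]
  exact h m hm r w hw

/-- FROM PER-LEVEL SHELL BOUNDS TO THE ROAD'S `hGtail` BINDER. [folklore] -/
theorem hGtail_of_levels {Lc : ℕ} (hL : 1 < Lc) {Φ : ℕ → Pt → ℝ} {S' : ℝ} {a : ℕ} {M : ℕ → ℕ}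
    (h : ∀ m : ℕ, 1 ≤ m → ∀ r : ℕ, ∀ w ∈ annulus 4 r (r + 1), |Φ m w| ≤ S' / ((r : ℝ) + 1) ^ a) :
    ∀ m : ℕ, 1 ≤ m → ∀ r : ℕ, M (Lc ^ m) ≤ r → ∀ w ∈ annulus 4 r (r + 1),
      |powIndexed Lc Φ (Lc ^ m) w| ≤ S' / ((r : ℝ) + 1) ^ a := by
  intro m hm r _ w hw
  rw [powIndexed_pow hL]
  exact h m hm r w hw

/-- A SEQUENCE OF SCALAR TOWERS along the road's exponents: `d = 4`, the road's fixed `L`, at least `m` levels available at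
index `m`, a base point per index. [folklore] -/
structure TowerSeq (L : ℕ) where
  Pf : ℕ → Params
  hd : ∀ m, (Pf m).d = 4
  hL : ∀ m, (Pf m).L = L
  hK : ∀ m, m ≤ (Pf m).m + (Pf m).K + 1
  x₀ : ∀ m, Balaban1983to89.Site (Pf m) 0

namespace TowerSeq

variable {L : ℕ} (𝒯 : TowerSeq L)

/-- A reference parameter record of the sequence (index `0`), carrying `(d, L) = (4, L)` for `legConst`, `cK0`, `dK0`. [folklore] -/
def P₀ : Params := 𝒯.Pf 0

/-- The value-leg family of the sequence, power-indexed: `F' (L^m) = valueLegPt (Pf m) …`. [folklore] -/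
def valueF (a msq : ℝ) : ℕ → Pt → ℝ := powIndexed L fun m => valueLegPt (𝒯.Pf m) a msq (𝒯.hd m) m (𝒯.x₀ m)

/-- The gradient-leg family (direction `μ : Fin 4`, re-indexed into each `Fin (Pf m).d`). [folklore] -/
def gradF (a msq : ℝ) (μ : Fin 4) : ℕ → Pt → ℝ :=
  powIndexed L fun m => gradLegPt (𝒯.Pf m) a msq (𝒯.hd m) m (Fin.cast (𝒯.hd m).symm μ) (𝒯.x₀ m)

/-- The mixed-leg family (directions `μ ν : Fin 4`). [folklore] -/
def mixedF (a msq : ℝ) (μ ν : Fin 4) : ℕ → Pt → ℝ :=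
  powIndexed L fun m =>
    mixedLegPt (𝒯.Pf m) a msq (𝒯.hd m) m (Fin.cast (𝒯.hd m).symm μ) (Fin.cast (𝒯.hd m).symm ν) (𝒯.x₀ m)

/-- `1 < L` along a tower sequence (from `Params.hL`). [folklore] -/
theorem one_lt_L (𝒯 : TowerSeq L) : 1 < L := by
  have h := (𝒯.Pf 0).hL.2
  rwa [𝒯.hL 0] at h

/-- Along the sequence `(d, L)` agree with the reference record. [folklore] -/
theorem legConst_eq (𝒯 : TowerSeq L) (m : ℕ) (c₀ δ₀' ā : ℝ) (s : ℕ) :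
    legConst (𝒯.Pf m) c₀ δ₀' ā s = legConst 𝒯.P₀ c₀ δ₀' ā s :=
  legConst_eq_of_eq (by rw [𝒯.hd m, P₀, 𝒯.hd 0]) (by rw [𝒯.hL m, P₀, 𝒯.hL 0]) c₀ δ₀' ā s

/-- **VALUE LEG OF A TOWER SEQUENCE, literal `hFtail` binder** (`a = 2`, `R′ = legConst`, `δ = ⅜δ₀′`, any window floor `M`),
modulo ONE uniform package `BlockLegDecay (Pf m) a m² c₀ δ₀′` along the sequence. [cite: Balaban1984PropagatorsI, (1.137) p.40] -/
theorem valueLeg_hFtail {a msq : ℝ} (ha : 0 < a) (hm : 0 ≤ msq) {c₀ δ₀' ā : ℝ} (hc : cK0 4 L a msq ≤ c₀)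
    (hδ : 0 < δ₀') (hδ' : δ₀' ≤ dK0 4 L a msq) (hā : ∀ j, |B1.aSeq a L j| ≤ ā)
    (H : ∀ m, BlockLegDecay (𝒯.Pf m) a msq c₀ δ₀') (M : ℕ → ℕ) :
    ∀ m : ℕ, 1 ≤ m → ∀ r : ℕ, M (L ^ m) ≤ r → ∀ w ∈ annulus 4 r (r + 1),
      |𝒯.valueF a msq (L ^ m) w| ≤ legConst 𝒯.P₀ c₀ δ₀' ā 2 / ((r : ℝ) + 1) ^ 2 *
        Real.exp (-(3 / 8 * δ₀' / ((L ^ m : ℕ) : ℝ)) * ((r : ℝ) + 1)) := by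
  unfold valueF
  refine hFtail_of_levels 𝒯.one_lt_L fun m hm1 r w hw => ?_
  have hd := 𝒯.hd m
  have hL := 𝒯.hL m
  have h := valueLeg_tailExp hd ha hm hm1 (𝒯.hK m) (by rw [hd, hL]; exact hc) hδ (by rw [hd, hL]; exact hδ')
    (by rw [hL]; exact hā) (H m) (𝒯.x₀ m) r w hw
  rw [hL, 𝒯.legConst_eq m] at h
  exact h

/-- **VALUE LEG OF A TOWER SEQUENCE, literal `hGtail` binder** (`a = 2`, `S′ = legConst`). [cite: Balaban1984PropagatorsI, (1.137) p.40] -/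
theorem valueLeg_hGtail {a msq : ℝ} (ha : 0 < a) (hm : 0 ≤ msq) {c₀ δ₀' ā : ℝ} (hc : cK0 4 L a msq ≤ c₀)
    (hδ : 0 < δ₀') (hδ' : δ₀' ≤ dK0 4 L a msq) (hā : ∀ j, |B1.aSeq a L j| ≤ ā)
    (H : ∀ m, BlockLegDecay (𝒯.Pf m) a msq c₀ δ₀') (M : ℕ → ℕ) :
    ∀ m : ℕ, 1 ≤ m → ∀ r : ℕ, M (L ^ m) ≤ r → ∀ w ∈ annulus 4 r (r + 1),
      |𝒯.valueF a msq (L ^ m) w| ≤ legConst 𝒯.P₀ c₀ δ₀' ā 2 / ((r : ℝ) + 1) ^ 2 := by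
  unfold valueF
  refine hGtail_of_levels 𝒯.one_lt_L fun m hm1 r w hw => ?_
  have hd := 𝒯.hd m
  have hL := 𝒯.hL m
  have h := valueLeg_tailPow hd ha hm hm1 (𝒯.hK m) (by rw [hd, hL]; exact hc) hδ (by rw [hd, hL]; exact hδ')
    (by rw [hL]; exact hā) (H m) (𝒯.x₀ m) r w hw
  rw [𝒯.legConst_eq m] at h
  exact h

/-- **GRADIENT LEG OF A TOWER SEQUENCE, `hFtail` binder** (`a = 3`). [cite: Balaban1984PropagatorsI, (1.137) p.40] -/
theorem gradLeg_hFtail {a msq : ℝ} (ha : 0 < a) (hm : 0 ≤ msq) {c₀ δ₀' ā : ℝ} (hc : cK0 4 L a msq ≤ c₀)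
    (hδ : 0 < δ₀') (hδ' : δ₀' ≤ dK0 4 L a msq) (hā : ∀ j, |B1.aSeq a L j| ≤ ā)
    (H : ∀ m, BlockLegDecay (𝒯.Pf m) a msq c₀ δ₀') (μ : Fin 4) (M : ℕ → ℕ) :
    ∀ m : ℕ, 1 ≤ m → ∀ r : ℕ, M (L ^ m) ≤ r → ∀ w ∈ annulus 4 r (r + 1),
      |𝒯.gradF a msq μ (L ^ m) w| ≤ legConst 𝒯.P₀ c₀ δ₀' ā 3 / ((r : ℝ) + 1) ^ 3 *
        Real.exp (-(3 / 8 * δ₀' / ((L ^ m : ℕ) : ℝ)) * ((r : ℝ) + 1)) := by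
  unfold gradF
  refine hFtail_of_levels 𝒯.one_lt_L fun m hm1 r w hw => ?_
  have hd := 𝒯.hd m
  have hL := 𝒯.hL m
  have h := gradLeg_tailExp hd ha hm hm1 (𝒯.hK m) (by rw [hd, hL]; exact hc) hδ (by rw [hd, hL]; exact hδ')
    (by rw [hL]; exact hā) (H m) (Fin.cast hd.symm μ) (𝒯.x₀ m) r w hw
  rw [hL, 𝒯.legConst_eq m] at h
  exact h

/-- **GRADIENT LEG OF A TOWER SEQUENCE, `hGtail` binder** (`a = 3`). [cite: Balaban1984PropagatorsI, (1.137) p.40] -/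
theorem gradLeg_hGtail {a msq : ℝ} (ha : 0 < a) (hm : 0 ≤ msq) {c₀ δ₀' ā : ℝ} (hc : cK0 4 L a msq ≤ c₀)
    (hδ : 0 < δ₀') (hδ' : δ₀' ≤ dK0 4 L a msq) (hā : ∀ j, |B1.aSeq a L j| ≤ ā)
    (H : ∀ m, BlockLegDecay (𝒯.Pf m) a msq c₀ δ₀') (μ : Fin 4) (M : ℕ → ℕ) :
    ∀ m : ℕ, 1 ≤ m → ∀ r : ℕ, M (L ^ m) ≤ r → ∀ w ∈ annulus 4 r (r + 1),
      |𝒯.gradF a msq μ (L ^ m) w| ≤ legConst 𝒯.P₀ c₀ δ₀' ā 3 / ((r : ℝ) + 1) ^ 3 := by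
  unfold gradF
  refine hGtail_of_levels 𝒯.one_lt_L fun m hm1 r w hw => ?_
  have hd := 𝒯.hd m
  have hL := 𝒯.hL m
  have h := gradLeg_tailPow hd ha hm hm1 (𝒯.hK m) (by rw [hd, hL]; exact hc) hδ (by rw [hd, hL]; exact hδ')
    (by rw [hL]; exact hā) (H m) (Fin.cast hd.symm μ) (𝒯.x₀ m) r w hw
  rw [𝒯.legConst_eq m] at h
  exact h

/-- **MIXED LEG OF A TOWER SEQUENCE, `hFtail` binder** (`a = 4`). [cite: Balaban1984PropagatorsI, (1.137) p.40] -/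
theorem mixedLeg_hFtail {a msq : ℝ} (ha : 0 < a) (hm : 0 ≤ msq) {c₀ δ₀' ā : ℝ} (hc : cK0 4 L a msq ≤ c₀)
    (hδ : 0 < δ₀') (hδ' : δ₀' ≤ dK0 4 L a msq) (hā : ∀ j, |B1.aSeq a L j| ≤ ā)
    (H : ∀ m, BlockLegDecay (𝒯.Pf m) a msq c₀ δ₀') (μ ν : Fin 4) (M : ℕ → ℕ) :
    ∀ m : ℕ, 1 ≤ m → ∀ r : ℕ, M (L ^ m) ≤ r → ∀ w ∈ annulus 4 r (r + 1),
      |𝒯.mixedF a msq μ ν (L ^ m) w| ≤ legConst 𝒯.P₀ c₀ δ₀' ā 4 / ((r : ℝ) + 1) ^ 4 *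
        Real.exp (-(3 / 8 * δ₀' / ((L ^ m : ℕ) : ℝ)) * ((r : ℝ) + 1)) := by
  unfold mixedF
  refine hFtail_of_levels 𝒯.one_lt_L fun m hm1 r w hw => ?_
  have hd := 𝒯.hd m
  have hL := 𝒯.hL m
  have h := mixedLeg_tailExp hd ha hm hm1 (𝒯.hK m) (by rw [hd, hL]; exact hc) hδ (by rw [hd, hL]; exact hδ')
    (by rw [hL]; exact hā) (H m) (Fin.cast hd.symm μ) (Fin.cast hd.symm ν) (𝒯.x₀ m) r w hw
  rw [hL, 𝒯.legConst_eq m] at h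
  exact h

/-- **MIXED LEG OF A TOWER SEQUENCE, `hGtail` binder** (`a = 4`). [cite: Balaban1984PropagatorsI, (1.137) p.40] -/
theorem mixedLeg_hGtail {a msq : ℝ} (ha : 0 < a) (hm : 0 ≤ msq) {c₀ δ₀' ā : ℝ} (hc : cK0 4 L a msq ≤ c₀)
    (hδ : 0 < δ₀') (hδ' : δ₀' ≤ dK0 4 L a msq) (hā : ∀ j, |B1.aSeq a L j| ≤ ā)
    (H : ∀ m, BlockLegDecay (𝒯.Pf m) a msq c₀ δ₀') (μ ν : Fin 4) (M : ℕ → ℕ) :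
    ∀ m : ℕ, 1 ≤ m → ∀ r : ℕ, M (L ^ m) ≤ r → ∀ w ∈ annulus 4 r (r + 1),
      |𝒯.mixedF a msq μ ν (L ^ m) w| ≤ legConst 𝒯.P₀ c₀ δ₀' ā 4 / ((r : ℝ) + 1) ^ 4 := by
  unfold mixedF
  refine hGtail_of_levels 𝒯.one_lt_L fun m hm1 r w hw => ?_
  have hd := 𝒯.hd m
  have hL := 𝒯.hL m
  have h := mixedLeg_tailPow hd ha hm hm1 (𝒯.hK m) (by rw [hd, hL]; exact hc) hδ (by rw [hd, hL]; exact hδ')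
    (by rw [hL]; exact hā) (H m) (Fin.cast hd.symm μ) (Fin.cast hd.symm ν) (𝒯.x₀ m) r w hw
  rw [𝒯.legConst_eq m] at h
  exact h

end TowerSeq

/-- Non-vacuity of the reading: the faithful box of the fine torus contains every `w` with `‖w‖_∞ ≤ L^{m+K}` (half the period),
in particular the whole window `‖w‖_∞ ≤ L^k` of any level `k ≤ m + K`. [folklore] -/
theorem two_mul_supNorm_le_of_le {w : Pt} {k : ℕ} (hk : k ≤ P.m + P.K) (hw : supNorm w ≤ P.L ^ k) :
    2 * supNorm w ≤ P.sitesPerDir 0 := by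
  unfold Params.sitesPerDir
  have h1 : P.L ^ k ≤ P.L ^ (P.m + P.K - 0) := by
    rw [Nat.sub_zero]
    exact Nat.pow_le_pow_right P.L_pos hk
  omega

end Beta.SliceLegsWindow

end

end Literature.MathematicalPhysics.QuantumFieldTheory.Balaban1983to89
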